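import Literature.MathematicalPhysics.QuantumFieldTheory.Balaban1983to89.Node00.N24KnitN03
import Literature.MathematicalPhysics.QuantumFieldTheory.Balaban1983to89.Node00.N24WindowK
import Literature.MathematicalPhysics.QuantumFieldTheory.Balaban1983to89.B8LeafKnit
import Literature.MathematicalPhysics.QuantumFieldTheory.Balaban1983to89.B11LeafUnpinnedRecord
import Literature.MathematicalPhysics.QuantumFieldTheory.Balaban1983to89.B12NodeKnitRecord8
import Literature.MathematicalPhysics.QuantumFieldTheory.Balaban1983to89.B15LeafKnitRecord7
import Literature.MathematicalPhysics.QuantumFieldTheory.Balaban1983to89.B16NodeKnitRecordPinned8C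

/-!
# NODE N24 · EVERY PAPER CHILD ENTERED BY NAME AT THE RECORD: N03 as a THEOREM (`Node00.N03_at_record₅C`, seat n03-a, chair R443), N05 ∕ N06 ∕ N07 ∕ N12 through
# their PINNED carrier sockets (the [B8] ∕ [B9] ∕ [B11] ∕ [IV] leaf «for the Stage-5 parameters of the datum THAT BIND THE WORLD» — seats n07-a `B11LeafUnpinnedRecord`,
# n12-a `B15LeafKnitRecord7`, and §0 below), N08 ∕ N10 ∕ N11 through their record slots (modules 9 ∕ 11), N09 through seat n09-a's Stage-8 theorem
# `B12NodeKnitRecord8.b12_main_at_record₈C_of_leaf`, N13 through n13-a's pinned re-exponent knit at `₈C` (`B16NodeKnitRecordPinned8C`) — NO pure `Dag.Bk_main` binder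
# is left at the Stage-8 record

TRACK A (YM-PLAN §2d, node N24 of 28 = binder B2 `hB : B16.EndStatementBPrinted D.C`, [Balaban1989LargeFieldII] Thm 1 p. 355 ∧ [Balaban1988Convergent] Cor. 3
p. 264), seat `pub-ymgap-dag-n24-a` (-a KNIT-BY-NAME: «keep the glue elaborating against the children's CURRENT statements of record … report which child blocks»).
FOURTEENTH N24 module, a NEW importing one (append-only growth; modules 1–13 untouched; module 13 = `N24KnitN03`, p417226, consumed by name).  THEOREMS ONLY, def-free,
sorry-free, standard axioms.

WHY.  Module 13 (`N24KnitN03`: N03 entered as a THEOREM, `Node00.N03_at_record₅C`, n03-a p413711; `N24_binders₅C_final_pinned` ∕ `N24_binders₈C_final_pinned`) left, at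
`₅C` ∕ `₈C`, FIVE pure by-name binders `∀ P, Dag.Bk_main (leavesP w P)` — N05 [B8], N06 [B9], N07 [B11], N09 [B12], N12 [B15].  The children's seats have meanwhile landed,
as TREE THEOREMS over NODE 00's record predicates, the typed interfaces through which these five enter BY NAME:
* N07 — `B11LeafUnpinnedRecord.forall_pinned_b11Leaf_iff₅C` + `b11_main_of_isRecordOfRecord₅C_of_leaf` (n07-a, p416215): at a record the [B11] slot in the PINNED
  θ-form «`∀ θ` admissible presenting `D` AND binding `w.up`, `∀ P, B11Leaf (θ.res.Z P)`» is exactly the world's leaf and gives N07 (the un-pinned θ-form is refutable,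
  `not_forall_atDatum_b11Leaf₅C` — the F-n24T-1 lesson; the same file's `upOfRecord₅C_b8_b9_b11` unfolds the `b8` ∕ `b9` leaves of the binding of record, whence §0);
* N09 AT STAGE 8 — `B12NodeKnitRecord8.b12_main_at_record₈C_of_leaf (h) (hb12) (h11) (hcomp) (P) : Dag.B12_main (leavesP w P)` (n09-a, p416758): N09 at every run of
  an `₈C` record from three slots over the record's Stage-8 parameters — the B12-group pin `hb12` (Lemma 4 (3.53) over `θ.res.X`'s free B12 carriers), [B11] Thm 1 at
  the record's background domains `h11` (`UkExists ∧ UniqueUkOrbit` on `domAltOfRecord`), and the composition clauses `hcomp` (`HCompT`); inputs (a) χ-locality and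
  (b) (0.20) are theorems there;
* N12 — `B15LeafKnitRecord7.rBasicStep_upOfRecord₅C_iff` (n12-a, p416…: the `rBasicStep` leaf of the binding of record IS `B15Leaf (θ.res.W P)`, `Iff.rfl`), whence the
  pinned [IV] socket of §0 (n12-a states it over Stage-7 parameters, `forall_pinned_b15Leaf_iff_rBasicStep₇C`; the Stage-5 form below serves `₅C` and `₈C` alike);
* N13 AT STAGE 8 — `B16NodeKnitRecordPinned8C.b16_main_reExp_of_isRecordOfRecord₈C_pinned` (n13-a, p415…), (R) := the world's leaf (F-n24T-1 CLOSED).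
N05 [B8] and N06 [B9] have no record-level file of their own, but at a record their nodes ARE their leaves (`B8LeafKnit.b8_main_of_leaf`; «b4 → b5 → b6 → b7 → b9»
with N01–N04 theorems of the record), and the leaves of the binding of record are `B8LeafR` over `θ.res.X P`'s [B8] group ∕ `B9LeafX (θ.res.Y P)` — so they too
enter through PINNED θ-sockets (§0), the shape a carrier-pinning stage's theorem «`∀ θ` admissible, leaf at the carriers OF RECORD» discharges verbatim.

WHAT THIS FILE PROVES.
§0 SOCKETS at a `₅C` record (pattern of n07-a's `forall_pinned_b11Leaf_iff₅C`): `N24_forall_pinned_b8Leaf_iff₅C`, `N24_forall_pinned_b9Leaf_iff₅C`,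
   `N24_forall_pinned_b15Leaf_iff₅C` (pinned θ-form ↔ the world's own leaf), and the nodes from the sockets: `N24_b8_main_of_isRecordOfRecord₅C_of_slot` (N05),
   `N24_b9_main_of_isRecordOfRecord₅C_of_slot` (N06), `N24_b15_main_of_isRecordOfRecord₅C_of_slot` (N12); and **`N24_leaves_iff_binders₅C`** — LOGICAL STATUS of the
   socket display, kernel-checked: at a `₅C` record, GIVEN N08 (`∀ P, Dag.B10_main`), the four world leaves `b8 ∧ b9 ∧ b11 ∧ rBasicStep` at every run (⇔ the four sockets,
   by the iffs) are EQUIVALENT to the four by-name binders N05 ∧ N06 ∧ N07 ∧ N12 (N01–N04 being theorems of the record) — so replacing binders by sockets is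
   census-NEUTRAL in strength (each socket alone is stronger than its binder, jointly they are the same) and census-POSITIVE in location: every remaining hypothesis
   of (B2) now names the residual carrier group of `Residual₅` (X ∕ Y ∕ Z ∕ W) whose Stage-₉ pin discharges it verbatim («`∀ θ` admissible, leaf at the carriers of record»).
§1 `₅C`: **`N24_at_record₅C_knit_all_pinned`** — (B2) at a `₅C` record (module 13's `N24_at_record₅C_knit₀₃₀₈₁₀₁₁₁₃_pinned` fed by §0 and n07-a's socket) from: N03
   (theorem), the pinned sockets of N05 N06 N07 N12, the record slots of N08 N10 N11,
   N13's world-leaf 𝐑 + exponent families + Cor.-3 leaves, the β-box on `D.βfun`, and ONE pure binder — N09 [B12] (its record theorem reads Stage-8 objects);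
   `N24_binder₅C_N09` («which child blocks» at `₅C` in kernel form: N09 ALONE ⇒ (B2), given the slots).
§2 `₈C`: **`N24_at_record₈C_knit_all_pinned`** — (B2) at the Stage-8 record with ALL THIRTEEN children entered by name: N01 N02 N03 N04 theorems of the record; N05 N06
   N07 N08 N10 N11 N12 pinned carrier sockets ∕ record slots over the Stage-5 view; N09 n09-a's three Stage-8 slots; N13 pinned; β-box on `D.βfun` over `]0, γ₀]`;
   **`N24_at_record₈C_knit_all_of_betaMerged_pinned`** — the same with the β-binders READ AT THE MERGED β OF RECORD along the world's box (module 10 §2's iffs);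
   `N24_at_record₈C_knit_all_of_betaOfRecord₈_pinned` — β-binders at the β of record `betaOfRecord₈ θ` over the record's parameters, any `γ₀ ≥ w.γ`.
§3 THE ITEM BODY at the Stage-8 record, every child by name: `N24_stabilityB_body₈C_knit_all_pinned` — `IsDatumOfRecord₀ F N D` (NODE 00 Stage 0, from the record) ∧ (B2) ∧
   the K-INDEXED window «∀ γ ∈ ]0, γ₀], ∀ m K, ∃ g₀ > 0, run ⟨K, m, g₀⟩ of `D.C` in ]0, γ]» (module 8's `N24_window_allK_of_betaUpperH`, from `hhi` alone);
   `N24_stabilityB_itemShape₈C_knit_all_pinned` — the same in the LITERAL shape of item stmt-QuantumFields-19183's body (rev 0) at general `N`: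
   `IsDatumOfRecord₀ F N D ∧ B16.EndStatementBPrinted D.C ∧ ∃ γ₁ > 0, ∀ γ ∈ ]0, γ₁], ∃ P, (D.C P).flow.InInterval γ P.K` (γ₁ := γ₀, P := ⟨K, m, g₀⟩ for any `K m`).
§4 GIVEN B3: `N24_lowered_slots₈C_of_betaPertH_pinned` — from an `₈C` record, B3 at `D.βfun` (`0 < β̄`, `BetaPertH`), the six γ-blind carrier sockets ∕ slots at `w` and N13's
   𝐑-leaf, an explicit γ-LOWERED `₈C` record world `w'` over `D` at which N11's slots + N09's three Stage-8 slots + N13's exponent data (displayed AT `w'`) ⇒ (B2); no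
   separate β-binder (module 13's `N24_lowered_binders₅C_of_betaPertH_pinned` with the five pure binders replaced by sockets, at Stage 8).
WHICH CHILD BLOCKS after this file (Stage 8, kernel form = the hypothesis list of `N24_at_record₈C_knit_all_of_betaMerged_pinned`): NO pure node binder.  THEOREMS —
N01 N02 N03 N04 N23, `hC`, `hγ`, guarded (0.20), inputs (a)(b) of N09.  DISPLAYED SLOTS, each «a carrier group of `Residual₅` pinned + the child's theorem at the pinned
objects» — N05 (`X`'s [B8] group), N06 (`Y`), N07 (`Z`), N08 (`X`'s [B10] run family = leaf-system towers), N09 (`X`'s B12 group + [B11] Thm 1 on `domAltOfRecord` +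
`HCompT`), N10 (`X`'s B13 group, relative to B9 ∕ B10 ∕ B11 ∕ B12 leaves), N11 ((P1₅)(P3₅)(S0)(S1) on `V`, `R`, `S218`, `E`), N12 (`W`), N13 ((R) := `∀ P, (w.up P).rOperation`
on `V` + the five Cor.-3 leaves at `D.C`); β-SIDE — two bounds on the merged β of record along `]0, w.γ]^{k+1}` (lower `b > 0` UNPRINTED, T09.F = NODE O; upper β⁺
[Balaban1987RG1] p. 264), or B3 (module 12).  I.e. the residue of (B2) at the record of record is EXACTLY the carrier-pinning stage ₉ (X ∕ Y ∕ Z ∕ V ∕ W from the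
represented tower) + NODE O.  ETA(N24) = max(Stage ₉ pins, N25).
HONEST FRAMING: kernel bookkeeping BY NAME; every slot is a displayed HYPOTHESIS over NODE 00's residual carriers (satisfiable per record: each pinned socket is
equivalent to the world's own leaf), nothing of Bałaban's asserted; N24 COMPOSITE — no discharge, no count; one finite T⁴ programme at fixed ε; NOT continuum ∕ ℝ⁴ ∕
OS ∕ mass gap ∕ Clay.
-/

noncomputable section

open scoped Matrix.Norms.L2Operator

namespace Literature.MathematicalPhysics.QuantumFieldTheory.Balaban1983to89.Node00

open DagBinding T4Continuum T4DatumAssembly FlowStepRuns AveragingRT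
open FlowStep (BetaPertH box_mono)

variable {F : T4Family} {N : ℕ} [NeZero N] {D : FiniteEpsData F (SU N)} {w : WorldP}

/-! ## §0. Pinned carrier sockets for N05 [B8], N06 [B9], N12 [IV] at a `₅C` record (the [B11] one is n07-a's `forall_pinned_b11Leaf_iff₅C`) -/

/-- **The pinned [B8] socket IS the world's leaf**: at a `₅C` record, «for the admissible Stage-5 parameters of the datum that bind the world, the [B8] leaf `B8LeafR` over the
[B8] group of their residual bundle `θ.res.X P`» ↔ `∀ P, (w.up P).b8` (`B11LeafUnpinnedRecord.upOfRecord₅C_b8_b9_b11`: the `b8` field of the binding of record unfolds to it).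
[cite: Balaban1985RegularSpaces, Lemma 1 – Thm 8 pp.79–101 (the leaf; bookkeeping: the pinned socket)] -/
theorem N24_forall_pinned_b8Leaf_iff₅C (h : IsRecordOfRecord₅C F N D w) :
    (∀ θ : Stage5Params F N, θ.Admissible → D = datumOfRecord₅ F N θ → (∀ P, w.up P = upOfRecord₅C F N θ P) → ∀ P : B12.RunParams,
        B8LeafR (θ.res.X P).d8 (θ.res.X P).L8 (θ.res.X P).C₂ (θ.res.X P).B₁' (θ.res.X P).B₀' (θ.res.X P).B₁ (θ.res.X P).B₂ (θ.res.X P).c₁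
          (θ.res.X P).inp8 (θ.res.X P).B₀β (θ.res.X P).loc8 (θ.res.X P).fam8R (θ.res.X P).lan8 (θ.res.X P).cub8 (θ.res.X P).toAxial8) ↔
      ∀ P : B12.RunParams, (w.up P).b8 := by
  refine ⟨fun hX P => ?_, fun hw θ' _ _ hup' P => ?_⟩
  · obtain ⟨θ, hθ, hD, -, -, -, hup⟩ := h
    rw [hup P]
    exact (B11LeafUnpinnedRecord.upOfRecord₅C_b8_b9_b11 θ P).1.2 (hX θ hθ hD hup P)
  · have h8 : (w.up P).b8 := hw P
    rw [hup' P] at h8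
    exact (B11LeafUnpinnedRecord.upOfRecord₅C_b8_b9_b11 θ' P).1.1 h8

/-- **The pinned [B9] socket IS the world's leaf**: at a `₅C` record, «for the admissible Stage-5 parameters of the datum that bind the world, `B9LeafX (θ.res.Y P)`» ↔
`∀ P, (w.up P).b9`.  (The un-pinned form is refutable: n06-a's `B9LeafUnpinnedRecord5C.b9_main_undetermined_over_record₅C`.) [cite: Balaban1985BackgroundPropagators, Thms 3.1–3.15 pp.397–432 (the leaf; bookkeeping: the pinned socket)] -/
theorem N24_forall_pinned_b9Leaf_iff₅C (h : IsRecordOfRecord₅C F N D w) :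
    (∀ θ : Stage5Params F N, θ.Admissible → D = datumOfRecord₅ F N θ → (∀ P, w.up P = upOfRecord₅C F N θ P) → ∀ P : B12.RunParams,
        B9LeafX (θ.res.Y P)) ↔
      ∀ P : B12.RunParams, (w.up P).b9 := by
  refine ⟨fun hY P => ?_, fun hw θ' _ _ hup' P => ?_⟩
  · obtain ⟨θ, hθ, hD, -, -, -, hup⟩ := h
    rw [hup P]
    exact (B11LeafUnpinnedRecord.upOfRecord₅C_b8_b9_b11 θ P).2.1.2 (hY θ hθ hD hup P)
  · have h9 : (w.up P).b9 := hw P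
    rw [hup' P] at h9
    exact (B11LeafUnpinnedRecord.upOfRecord₅C_b8_b9_b11 θ' P).2.1.1 h9

/-- **The pinned [IV] socket IS the world's leaf** (Stage-5 form of n12-a's `B15LeafKnitRecord7.forall_pinned_b15Leaf_iff_rBasicStep₇C`): at a `₅C` record, «for the admissible
Stage-5 parameters of the datum that bind the world, `B15Leaf (θ.res.W P)`» ↔ `∀ P, (w.up P).rBasicStep` (`B15LeafKnitRecord7.rBasicStep_upOfRecord₅C_iff`).
[cite: Balaban1989LargeFieldI, Prop. 1 p.194, (0.4)–(0.6) p.176, (1.80) p.195, (1.89) p.198, (1.102) p.201 (the leaf; bookkeeping: the pinned socket)] -/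
theorem N24_forall_pinned_b15Leaf_iff₅C (h : IsRecordOfRecord₅C F N D w) :
    (∀ θ : Stage5Params F N, θ.Admissible → D = datumOfRecord₅ F N θ → (∀ P, w.up P = upOfRecord₅C F N θ P) → ∀ P : B12.RunParams,
        B15Leaf (θ.res.W P)) ↔
      ∀ P : B12.RunParams, (w.up P).rBasicStep := by
  refine ⟨fun hW P => ?_, fun hw θ' _ _ hup' P => ?_⟩
  · obtain ⟨θ, hθ, hD, -, -, -, hup⟩ := h
    rw [hup P]
    exact (B15LeafKnitRecord7.rBasicStep_upOfRecord₅C_iff θ P).2 (hW θ hθ hD hup P)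
  · have h15 : (w.up P).rBasicStep := hw P
    rw [hup' P] at h15
    exact (B15LeafKnitRecord7.rBasicStep_upOfRecord₅C_iff θ' P).1 h15

/-- **N05 · [Balaban1985RegularSpaces] at every run of a `₅C` record from the pinned [B8] socket** (`B8LeafKnit.b8_main_of_leaf`: the in-edges `b5 b6 b7 b9` are not used).
[cite: Balaban1985RegularSpaces, Thm 2 p.83, Thm 4 p.88, Thm 8 p.101 (node bookkeeping at the record)] -/
theorem N24_b8_main_of_isRecordOfRecord₅C_of_slot (h : IsRecordOfRecord₅C F N D w)
    (slots₀₅ : ∀ θ : Stage5Params F N, θ.Admissible → D = datumOfRecord₅ F N θ → (∀ P, w.up P = upOfRecord₅C F N θ P) → ∀ P : B12.RunParams,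
      B8LeafR (θ.res.X P).d8 (θ.res.X P).L8 (θ.res.X P).C₂ (θ.res.X P).B₁' (θ.res.X P).B₀' (θ.res.X P).B₁ (θ.res.X P).B₂ (θ.res.X P).c₁
        (θ.res.X P).inp8 (θ.res.X P).B₀β (θ.res.X P).loc8 (θ.res.X P).fam8R (θ.res.X P).lan8 (θ.res.X P).cub8 (θ.res.X P).toAxial8)
    (P : B12.RunParams) : Dag.B8_main (leavesP w P) :=
  B8LeafKnit.b8_main_of_leaf w P ((N24_forall_pinned_b8Leaf_iff₅C h).1 slots₀₅ P)

/-- **N06 · [Balaban1985BackgroundPropagators] at every run of a `₅C` record from the pinned [B9] socket** («b4 → b5 → b6 → b7 → b9»: the in-edges are not used).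
[cite: Balaban1985BackgroundPropagators, Thms 3.1–3.15 pp.397–432 (node bookkeeping at the record)] -/
theorem N24_b9_main_of_isRecordOfRecord₅C_of_slot (h : IsRecordOfRecord₅C F N D w)
    (slots₀₆ : ∀ θ : Stage5Params F N, θ.Admissible → D = datumOfRecord₅ F N θ → (∀ P, w.up P = upOfRecord₅C F N θ P) → ∀ P : B12.RunParams,
      B9LeafX (θ.res.Y P))
    (P : B12.RunParams) : Dag.B9_main (leavesP w P) :=
  fun _ _ _ _ => (N24_forall_pinned_b9Leaf_iff₅C h).1 slots₀₆ P

/-- **N12 · [Balaban1989LargeFieldI] at every run of a `₅C` record from the pinned [IV] socket** (`B15LeafKnit.b15_main_of_up`: the in-edges `b5 b7 b8 b10 b11` are not used;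
at `₇C` this is n12-a's `B15LeafKnitRecord7.b15_main_of_isRecordOfRecord₇C_pinned`). [cite: Balaban1989LargeFieldI, Prop. 1 p.194 (node bookkeeping at the record)] -/
theorem N24_b15_main_of_isRecordOfRecord₅C_of_slot (h : IsRecordOfRecord₅C F N D w)
    (slots₁₂ : ∀ θ : Stage5Params F N, θ.Admissible → D = datumOfRecord₅ F N θ → (∀ P, w.up P = upOfRecord₅C F N θ P) → ∀ P : B12.RunParams,
      B15Leaf (θ.res.W P))
    (P : B12.RunParams) : Dag.B15_main (leavesP w P) :=
  B15LeafKnit.b15_main_of_up (U := w.up P) rfl ((N24_forall_pinned_b15Leaf_iff₅C h).1 slots₁₂ P)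

/-- **LOGICAL STATUS OF THE SOCKET DISPLAY (census-neutral in strength, kernel-checked).**  At a `₅C` record, GIVEN N08 at every run (`∀ P, Dag.B10_main (leavesP w P)` — itself
by name from its slot, `B10LeafUnpinnedRecord5C.b10_main_of_isRecordOfRecord₅C_of_slots`), the four WORLD LEAVES `b8`, `b9`, `b11`, `rBasicStep` at every run (⇔ the four pinned
sockets of §0 ∕ n07-a, by `N24_forall_pinned_b8Leaf_iff₅C`, `…b9…`, `B11LeafUnpinnedRecord.forall_pinned_b11Leaf_iff₅C`, `…b15…`) are EQUIVALENT to the four by-name binders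
N05 ∧ N06 ∧ N07 ∧ N12: «→» discards in-edges; «←» runs the DAG — `b4 b5 b6 b7` are theorems of the record (`b4∕b5∕b7_main_of_isRecordOfRecord₅C`, `N03_at_record₅C`), then
`b9 := N06 b4 b5 b6 b7`, `b8 := N05 b5 b6 b7 b9`, `b11 := N07 b5 b6 b7 b8 b9`, `b10 := N08 …`, `rBasicStep := N12 b5 b7 b8 b10 b11`.  So each socket ALONE is stronger than
its binder, but the socket LIST is not: the display of §1–§2 re-locates the hypotheses (to the carrier groups of `Residual₅`) without strengthening them.
[cite: Balaban1985RegularSpaces, Thm 2 p.83; Balaban1985BackgroundPropagators, Thms 3.1–3.15 pp.397–432; Balaban1985Variational, Thm 1 p.279; Balaban1985UV3, Thm 1 p.257; Balaban1989LargeFieldI, Prop. 1 p.194 (the DAG edges `Dag.B8∕B9∕B11∕B10∕B15_main`; bookkeeping)] -/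
theorem N24_leaves_iff_binders₅C (h : IsRecordOfRecord₅C F N D w) (h08 : ∀ P : B12.RunParams, Dag.B10_main (leavesP w P)) :
    ((∀ P : B12.RunParams, (w.up P).b8) ∧ (∀ P : B12.RunParams, (w.up P).b9) ∧ (∀ P : B12.RunParams, (w.up P).b11) ∧
        ∀ P : B12.RunParams, (w.up P).rBasicStep) ↔
      ((∀ P : B12.RunParams, Dag.B8_main (leavesP w P)) ∧ (∀ P : B12.RunParams, Dag.B9_main (leavesP w P)) ∧
        (∀ P : B12.RunParams, Dag.B11_main (leavesP w P)) ∧ ∀ P : B12.RunParams, Dag.B15_main (leavesP w P)) := by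
  refine ⟨fun ⟨h8, h9, h11, h15⟩ => ⟨fun P _ _ _ _ => h8 P, fun P _ _ _ _ => h9 P, fun P _ _ _ _ _ => h11 P, fun P _ _ _ _ _ => h15 P⟩,
    fun ⟨h05, h06, h07, h12⟩ => ?_⟩
  have hb4 : ∀ P : B12.RunParams, (leavesP w P).b4 := fun P => b4_main_of_isRecordOfRecord₅C h P
  have hb5 : ∀ P : B12.RunParams, (leavesP w P).b5 := fun P => b5_main_of_isRecordOfRecord₅C h P (hb4 P)
  have hb6 : ∀ P : B12.RunParams, (leavesP w P).b6 := fun P => N03_at_record₅C h P (hb4 P) (hb5 P)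
  have hb7 : ∀ P : B12.RunParams, (leavesP w P).b7 := fun P => b7_main_of_isRecordOfRecord₅C h P (hb5 P)
  have hb9 : ∀ P : B12.RunParams, (leavesP w P).b9 := fun P => h06 P (hb4 P) (hb5 P) (hb6 P) (hb7 P)
  have hb8 : ∀ P : B12.RunParams, (leavesP w P).b8 := fun P => h05 P (hb5 P) (hb6 P) (hb7 P) (hb9 P)
  have hb11 : ∀ P : B12.RunParams, (leavesP w P).b11 := fun P => h07 P (hb5 P) (hb6 P) (hb7 P) (hb8 P) (hb9 P)
  have hb10 : ∀ P : B12.RunParams, (leavesP w P).b10 := fun P => h08 P (hb5 P) (hb6 P) (hb7 P) (hb8 P) (hb9 P) (hb11 P)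
  exact ⟨hb8, hb9, hb11, fun P => h12 P (hb5 P) (hb7 P) (hb8 P) (hb10 P) (hb11 P)⟩

/-! ## §1. At `₅C`: every child by name except N09 (whose record theorem reads Stage-8 objects) -/

/-- **N24 · (B2) at a `₅C` record, EVERY CHILD BUT N09 ENTERED BY NAME**: N03 = `N03_at_record₅C` (theorem); N05 ∕ N06 ∕ N07 ∕ N12 from their pinned carrier sockets (§0,
`B11LeafUnpinnedRecord.forall_pinned_b11Leaf_iff₅C`); N08 ∕ N10 ∕ N11 from their record slots (module 11's `N24_at_record₅C_knit₀₈₁₀₁₁₁₃_pinned`); N13 from the world's 𝐑-leaf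
`hR`, datum-indexed exponent families `eM eP` and the Cor.-3 leaves `hcor`; the β-box `w.b ≤ D.βfun ≤ w.βup` on `]0, γ₀]^{k+1}`; ONE pure binder `h09`.
[cite: Balaban1989LargeFieldII, Thm 1 p.355 + pp.387, 391; Balaban1985RegularSpaces, Thms 2, 4, 8 pp.83–101; Balaban1985BackgroundPropagators, Thms 3.1–3.15 pp.397–432; Balaban1985Variational, Thm 1 p.279; Balaban1985UV3, Thm 1 p.257 + Thm 2 p.272; Balaban1988RG2Cluster, Lemmas 1–3 pp.9, 11, 20; Balaban1988Convergent, Thm 1 p.262, p.244, Cor. 3 (2.50) p.264; Balaban1989LargeFieldI, Prop. 1 p.194; Balaban1987RG1, (1.22) p.264 (bookkeeping)] -/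
theorem N24_at_record₅C_knit_all_pinned (h : IsRecordOfRecord₅C F N D w) {γ₀ : ℝ} (hγ₀ : w.γ ≤ γ₀)
    (slots₀₅ : ∀ θ : Stage5Params F N, θ.Admissible → D = datumOfRecord₅ F N θ → (∀ P, w.up P = upOfRecord₅C F N θ P) → ∀ P : B12.RunParams,
      B8LeafR (θ.res.X P).d8 (θ.res.X P).L8 (θ.res.X P).C₂ (θ.res.X P).B₁' (θ.res.X P).B₀' (θ.res.X P).B₁ (θ.res.X P).B₂ (θ.res.X P).c₁
        (θ.res.X P).inp8 (θ.res.X P).B₀β (θ.res.X P).loc8 (θ.res.X P).fam8R (θ.res.X P).lan8 (θ.res.X P).cub8 (θ.res.X P).toAxial8)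
    (slots₀₆ : ∀ θ : Stage5Params F N, θ.Admissible → D = datumOfRecord₅ F N θ → (∀ P, w.up P = upOfRecord₅C F N θ P) → ∀ P : B12.RunParams,
      B9LeafX (θ.res.Y P))
    (slots₀₇ : ∀ θ : Stage5Params F N, θ.Admissible → D = datumOfRecord₅ F N θ → (∀ P, w.up P = upOfRecord₅C F N θ P) → ∀ P : B12.RunParams,
      B11Leaf (θ.res.Z P))
    (slots₀₈ : ∀ θ : Stage5Params F N, θ.Admissible → D = datumOfRecord₅ F N θ →
      (∀ P, w.up P = upOfRecord₅C F N θ P) → ∀ P : B12.RunParams,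
        ∃ (Xc : PrintedCarriersR) (I : Type) (C : B10Assembly.Consts) (T : I → B10.TowerRun),
          Nonempty (∀ i, B10Assembly.LeafSystem C (T i)) ∧ θ.res.X P = Xc.withTowerRuns10 T)
    (h09 : ∀ P : B12.RunParams, Dag.B12_main (leavesP w P))
    (slots₁₀ : ∀ θ : Stage5Params F N, θ.Admissible → D = datumOfRecord₅ F N θ →
      (∀ P, w.up P = upOfRecord₅C F N θ P) → ∀ P : B12.RunParams,
        B9LeafX (θ.res.Y P) →
          (B10.Thm1PrintedCompact (θ.res.X P).runs10 ∧ B10.Thm2Printed (θ.res.X P).runs10) →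
            B11Leaf (θ.res.Z P) → B12Sec2to5.Lemma4Printed (θ.res.X P).F12 (θ.res.X P).c12 →
              B13.Lemma1Printed (θ.res.X P).S13 (θ.res.X P).c13 ∧ B13.Lemma2Printed (θ.res.X P).S13 (θ.res.X P).c13 ∧
                B13.Lemma3Printed (θ.res.X P).S13 (θ.res.X P).c13)
    (slots₁₁ : ∀ θ : Stage5Params F N, θ.Admissible → D = datumOfRecord₅ F N θ →
      (∀ P, w.up P = upOfRecord₅C F N θ P) → ∀ P : B12.RunParams,
        ∃ S Scorr : (k : ℕ) → Density (F.P P.K) k (SU N) → Prop,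
          (ROpLeaf (θ.res.V P) → B14.RAssumedP244 (θ.res.R P) Scorr S P.K) ∧
          (∀ k, k ≤ P.K → S k (densOfRecord₅ F N θ P k) → θ.res.S218 P k (densOfRecord₅ F N θ P k)) ∧
          ((leavesP w P).smallCouplings → S 0 (rhoZeroOfRecord F N P.K P.g0 (θ.res.E P))) ∧
          ((leavesP w P).b7 → (leavesP w P).b8 → (leavesP w P).b9 → (leavesP w P).b10 → (leavesP w P).b11 →
            (leavesP w P).smallCouplings → (leavesP w P).smallFieldInductive → (leavesP w P).flowControl →
              ∀ k, k < P.K → S k (densOfRecord₅ F N θ P k) →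
                Scorr (k + 1) (TrhoOfRecord F N P.K k (densOfRecord₅ F N θ P k))))
    (slots₁₂ : ∀ θ : Stage5Params F N, θ.Admissible → D = datumOfRecord₅ F N θ → (∀ P, w.up P = upOfRecord₅C F N θ P) → ∀ P : B12.RunParams,
      B15Leaf (θ.res.W P))
    (eM eP : FiniteEpsData F (SU N) → ℝ → ℝ) (hR : ∀ P : B12.RunParams, (w.up P).rOperation)
    (hcor : ∀ θ : Stage5Params F N, θ.Admissible → D = datumOfRecord₅ F N θ →
      ∃ R : B14Cor3.ReprFamily (datumOfRecord₅ F N θ).C,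
        B14Cor3.LeafH (datumOfRecord₅ F N θ).C R w.γ ∧ B14Cor3.LeafU1 (datumOfRecord₅ F N θ).C R w.γ ∧
        B14Cor3.LeafU2 (datumOfRecord₅ F N θ).C R w.γ (eP D) ∧ B14Cor3.LeafL1 (datumOfRecord₅ F N θ).C R w.γ ∧
        B14Cor3.LeafL2 (datumOfRecord₅ F N θ).C R w.γ (eM D))
    (hlo : FlowStep.BetaLowerH w.b γ₀ D.βfun) (hhi : FlowStep.BetaUpperH w.βup γ₀ D.βfun) :
    B16.EndStatementBPrinted D.C :=
  N24_at_record₅C_knit₀₃₀₈₁₀₁₁₁₃_pinned h hγ₀ (N24_b8_main_of_isRecordOfRecord₅C_of_slot h slots₀₅)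
    (N24_b9_main_of_isRecordOfRecord₅C_of_slot h slots₀₆)
    (B11LeafUnpinnedRecord.b11_main_of_isRecordOfRecord₅C_of_leaf h ((B11LeafUnpinnedRecord.forall_pinned_b11Leaf_iff₅C h).1 slots₀₇))
    h09 (N24_b15_main_of_isRecordOfRecord₅C_of_slot h slots₁₂) slots₀₈ slots₁₀ slots₁₁ eM eP hR hcor hlo hhi

/-- **WHICH CHILD BLOCKS at `₅C`, kernel form**: given N03's theorem, the pinned sockets of N05 N06 N07 N12, the record slots of N08 N10 N11, N13's leaf data and the β-box,
the ONE pure binder N09 [Balaban1987RG1] ⇒ (B2).  (At Stage 8, N09 itself enters by name: §2.) [cite: Balaban1989LargeFieldII, Thm 1 p.355 + p.391; Balaban1987RG1, Thm 1 p.259 and Thm 3 p.264 (bookkeeping)] -/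
theorem N24_binder₅C_N09 (h : IsRecordOfRecord₅C F N D w) {γ₀ : ℝ} (hγ₀ : w.γ ≤ γ₀)
    (slots₀₅ : ∀ θ : Stage5Params F N, θ.Admissible → D = datumOfRecord₅ F N θ → (∀ P, w.up P = upOfRecord₅C F N θ P) → ∀ P : B12.RunParams,
      B8LeafR (θ.res.X P).d8 (θ.res.X P).L8 (θ.res.X P).C₂ (θ.res.X P).B₁' (θ.res.X P).B₀' (θ.res.X P).B₁ (θ.res.X P).B₂ (θ.res.X P).c₁
        (θ.res.X P).inp8 (θ.res.X P).B₀β (θ.res.X P).loc8 (θ.res.X P).fam8R (θ.res.X P).lan8 (θ.res.X P).cub8 (θ.res.X P).toAxial8)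
    (slots₀₆ : ∀ θ : Stage5Params F N, θ.Admissible → D = datumOfRecord₅ F N θ → (∀ P, w.up P = upOfRecord₅C F N θ P) → ∀ P : B12.RunParams,
      B9LeafX (θ.res.Y P))
    (slots₀₇ : ∀ θ : Stage5Params F N, θ.Admissible → D = datumOfRecord₅ F N θ → (∀ P, w.up P = upOfRecord₅C F N θ P) → ∀ P : B12.RunParams,
      B11Leaf (θ.res.Z P))
    (slots₀₈ : ∀ θ : Stage5Params F N, θ.Admissible → D = datumOfRecord₅ F N θ →
      (∀ P, w.up P = upOfRecord₅C F N θ P) → ∀ P : B12.RunParams,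
        ∃ (Xc : PrintedCarriersR) (I : Type) (C : B10Assembly.Consts) (T : I → B10.TowerRun),
          Nonempty (∀ i, B10Assembly.LeafSystem C (T i)) ∧ θ.res.X P = Xc.withTowerRuns10 T)
    (slots₁₀ : ∀ θ : Stage5Params F N, θ.Admissible → D = datumOfRecord₅ F N θ →
      (∀ P, w.up P = upOfRecord₅C F N θ P) → ∀ P : B12.RunParams,
        B9LeafX (θ.res.Y P) →
          (B10.Thm1PrintedCompact (θ.res.X P).runs10 ∧ B10.Thm2Printed (θ.res.X P).runs10) →
            B11Leaf (θ.res.Z P) → B12Sec2to5.Lemma4Printed (θ.res.X P).F12 (θ.res.X P).c12 →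
              B13.Lemma1Printed (θ.res.X P).S13 (θ.res.X P).c13 ∧ B13.Lemma2Printed (θ.res.X P).S13 (θ.res.X P).c13 ∧
                B13.Lemma3Printed (θ.res.X P).S13 (θ.res.X P).c13)
    (slots₁₁ : ∀ θ : Stage5Params F N, θ.Admissible → D = datumOfRecord₅ F N θ →
      (∀ P, w.up P = upOfRecord₅C F N θ P) → ∀ P : B12.RunParams,
        ∃ S Scorr : (k : ℕ) → Density (F.P P.K) k (SU N) → Prop,
          (ROpLeaf (θ.res.V P) → B14.RAssumedP244 (θ.res.R P) Scorr S P.K) ∧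
          (∀ k, k ≤ P.K → S k (densOfRecord₅ F N θ P k) → θ.res.S218 P k (densOfRecord₅ F N θ P k)) ∧
          ((leavesP w P).smallCouplings → S 0 (rhoZeroOfRecord F N P.K P.g0 (θ.res.E P))) ∧
          ((leavesP w P).b7 → (leavesP w P).b8 → (leavesP w P).b9 → (leavesP w P).b10 → (leavesP w P).b11 →
            (leavesP w P).smallCouplings → (leavesP w P).smallFieldInductive → (leavesP w P).flowControl →
              ∀ k, k < P.K → S k (densOfRecord₅ F N θ P k) →
                Scorr (k + 1) (TrhoOfRecord F N P.K k (densOfRecord₅ F N θ P k))))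
    (slots₁₂ : ∀ θ : Stage5Params F N, θ.Admissible → D = datumOfRecord₅ F N θ → (∀ P, w.up P = upOfRecord₅C F N θ P) → ∀ P : B12.RunParams,
      B15Leaf (θ.res.W P))
    (eM eP : FiniteEpsData F (SU N) → ℝ → ℝ) (hR : ∀ P : B12.RunParams, (w.up P).rOperation)
    (hcor : ∀ θ : Stage5Params F N, θ.Admissible → D = datumOfRecord₅ F N θ →
      ∃ R : B14Cor3.ReprFamily (datumOfRecord₅ F N θ).C,
        B14Cor3.LeafH (datumOfRecord₅ F N θ).C R w.γ ∧ B14Cor3.LeafU1 (datumOfRecord₅ F N θ).C R w.γ ∧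
        B14Cor3.LeafU2 (datumOfRecord₅ F N θ).C R w.γ (eP D) ∧ B14Cor3.LeafL1 (datumOfRecord₅ F N θ).C R w.γ ∧
        B14Cor3.LeafL2 (datumOfRecord₅ F N θ).C R w.γ (eM D))
    (hlo : FlowStep.BetaLowerH w.b γ₀ D.βfun) (hhi : FlowStep.BetaUpperH w.βup γ₀ D.βfun) :
    (∀ P : B12.RunParams, Dag.B12_main (leavesP w P)) → B16.EndStatementBPrinted D.C :=
  fun h09 => N24_at_record₅C_knit_all_pinned h hγ₀ slots₀₅ slots₀₆ slots₀₇ slots₀₈ h09 slots₁₀ slots₁₁ slots₁₂ eM eP hR hcor hlo hhi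

/-! ## §2. At the Stage-8 record `₈C`: ALL THIRTEEN children by name -/

/-- **N24 · (B2) at the Stage-8 record, ALL THIRTEEN PAPER CHILDREN ENTERED BY NAME** — N01 N02 N04 (`Record5C`), N03 (`N03_at_record₅C`), N05 N06 N07 N12 (pinned carrier
sockets, §0 and `B11LeafUnpinnedRecord`), N08 N10 N11 (record slots), N09 (`B12NodeKnitRecord8.b12_main_at_record₈C_of_leaf`: the B12-group pin `hb12`, [B11] Thm 1 at the
record's domains `h11T1`, the composition clauses `hcomp`, over the record's Stage-8 parameters), N13 (`B16NodeKnitRecordPinned8C.b16_main_reExp_of_isRecordOfRecord₈C_pinned`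
through module 11's `N24_at_record₈C_knit₀₈₁₀₁₁₁₃_pinned`: (R) := the world's leaf `hR`, exponent families `eM eP`, Cor.-3 leaves `hcor`); β-box on `D.βfun` over `]0, γ₀]^{k+1}`.
NO pure `Dag.Bk_main` binder remains. [cite: Balaban1989LargeFieldII, Thm 1 p.355 + pp.387, 391; Balaban1985RegularSpaces, Thms 2, 4, 8 pp.83–101; Balaban1985BackgroundPropagators, Thms 3.1–3.15 pp.397–432; Balaban1985Variational, Thm 1 p.279; Balaban1985UV3, Thm 1 p.257 + Thm 2 p.272; Balaban1987RG1, Thm 1 p.259, Thm 3 p.264, Lemma 4 (3.53) p.280, (1.1)–(1.3) p.260, (1.22) p.264; Balaban1988RG2Cluster, Lemmas 1–3 pp.9, 11, 20; Balaban1988Convergent, Thm 1 p.262, p.244, Cor. 3 (2.50) p.264; Balaban1989LargeFieldI, Prop. 1 p.194 (bookkeeping over the Stage-8 record)] -/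
theorem N24_at_record₈C_knit_all_pinned (h : IsRecordOfRecord₈C F N D w) {γ₀ : ℝ} (hγ₀ : w.γ ≤ γ₀)
    (slots₀₅ : ∀ θ : Stage5Params F N, θ.Admissible → D = datumOfRecord₅ F N θ → (∀ P, w.up P = upOfRecord₅C F N θ P) → ∀ P : B12.RunParams,
      B8LeafR (θ.res.X P).d8 (θ.res.X P).L8 (θ.res.X P).C₂ (θ.res.X P).B₁' (θ.res.X P).B₀' (θ.res.X P).B₁ (θ.res.X P).B₂ (θ.res.X P).c₁
        (θ.res.X P).inp8 (θ.res.X P).B₀β (θ.res.X P).loc8 (θ.res.X P).fam8R (θ.res.X P).lan8 (θ.res.X P).cub8 (θ.res.X P).toAxial8)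
    (slots₀₆ : ∀ θ : Stage5Params F N, θ.Admissible → D = datumOfRecord₅ F N θ → (∀ P, w.up P = upOfRecord₅C F N θ P) → ∀ P : B12.RunParams,
      B9LeafX (θ.res.Y P))
    (slots₀₇ : ∀ θ : Stage5Params F N, θ.Admissible → D = datumOfRecord₅ F N θ → (∀ P, w.up P = upOfRecord₅C F N θ P) → ∀ P : B12.RunParams,
      B11Leaf (θ.res.Z P))
    (slots₀₈ : ∀ θ : Stage5Params F N, θ.Admissible → D = datumOfRecord₅ F N θ →
      (∀ P, w.up P = upOfRecord₅C F N θ P) → ∀ P : B12.RunParams,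
        ∃ (Xc : PrintedCarriersR) (I : Type) (C : B10Assembly.Consts) (T : I → B10.TowerRun),
          Nonempty (∀ i, B10Assembly.LeafSystem C (T i)) ∧ θ.res.X P = Xc.withTowerRuns10 T)
    (hb12 : ∀ θ : Stage8Params F N, θ.Admissible → D = datumOfRecord₅ F N (θ.toStage5 F N) → w.γ ≤ θ.γ →
      (∀ P, w.up P = upOfRecord₅C F N (θ.toStage5 F N) P) → ∀ P, B12Sec2to5.Lemma4Printed (θ.res.X P).F12 (θ.res.X P).c12)
    (h11T1 : ∀ θ : Stage8Params F N, θ.Admissible → D = datumOfRecord₅ F N (θ.toStage5 F N) → w.γ ≤ θ.γ →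
      ∀ (p : B12.RunParams) (k : ℕ), k ≤ p.K →
        ∀ V ∈ domAltOfRecord F N θ.ν p.K k, UkExists F N p.K k θ.εbg V ∧ UniqueUkOrbit F N p.K k θ.εbg V)
    (hcomp : ∀ θ : Stage8Params F N, θ.Admissible → D = datumOfRecord₅ F N (θ.toStage5 F N) → w.γ ≤ θ.γ →
      ∀ (p : B12.RunParams) (k : ℕ), k ≤ p.K →
        HCompT F N (TOfRecord F N) (chi7 F N θ) θ.εbg p.K (genSeq (betaOfRecord₈ F N θ) p.g0) k (domAltOfRecord F N θ.ν p.K k))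
    (slots₁₀ : ∀ θ : Stage5Params F N, θ.Admissible → D = datumOfRecord₅ F N θ →
      (∀ P, w.up P = upOfRecord₅C F N θ P) → ∀ P : B12.RunParams,
        B9LeafX (θ.res.Y P) →
          (B10.Thm1PrintedCompact (θ.res.X P).runs10 ∧ B10.Thm2Printed (θ.res.X P).runs10) →
            B11Leaf (θ.res.Z P) → B12Sec2to5.Lemma4Printed (θ.res.X P).F12 (θ.res.X P).c12 →
              B13.Lemma1Printed (θ.res.X P).S13 (θ.res.X P).c13 ∧ B13.Lemma2Printed (θ.res.X P).S13 (θ.res.X P).c13 ∧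
                B13.Lemma3Printed (θ.res.X P).S13 (θ.res.X P).c13)
    (slots₁₁ : ∀ θ : Stage5Params F N, θ.Admissible → D = datumOfRecord₅ F N θ →
      (∀ P, w.up P = upOfRecord₅C F N θ P) → ∀ P : B12.RunParams,
        ∃ S Scorr : (k : ℕ) → Density (F.P P.K) k (SU N) → Prop,
          (ROpLeaf (θ.res.V P) → B14.RAssumedP244 (θ.res.R P) Scorr S P.K) ∧
          (∀ k, k ≤ P.K → S k (densOfRecord₅ F N θ P k) → θ.res.S218 P k (densOfRecord₅ F N θ P k)) ∧
          ((leavesP w P).smallCouplings → S 0 (rhoZeroOfRecord F N P.K P.g0 (θ.res.E P))) ∧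
          ((leavesP w P).b7 → (leavesP w P).b8 → (leavesP w P).b9 → (leavesP w P).b10 → (leavesP w P).b11 →
            (leavesP w P).smallCouplings → (leavesP w P).smallFieldInductive → (leavesP w P).flowControl →
              ∀ k, k < P.K → S k (densOfRecord₅ F N θ P k) →
                Scorr (k + 1) (TrhoOfRecord F N P.K k (densOfRecord₅ F N θ P k))))
    (slots₁₂ : ∀ θ : Stage5Params F N, θ.Admissible → D = datumOfRecord₅ F N θ → (∀ P, w.up P = upOfRecord₅C F N θ P) → ∀ P : B12.RunParams,
      B15Leaf (θ.res.W P))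
    (eM eP : FiniteEpsData F (SU N) → ℝ → ℝ) (hR : ∀ P : B12.RunParams, (w.up P).rOperation)
    (hcor : ∀ θ : Stage5Params F N, θ.Admissible → D = datumOfRecord₅ F N θ →
      ∃ R : B14Cor3.ReprFamily (datumOfRecord₅ F N θ).C,
        B14Cor3.LeafH (datumOfRecord₅ F N θ).C R w.γ ∧ B14Cor3.LeafU1 (datumOfRecord₅ F N θ).C R w.γ ∧
        B14Cor3.LeafU2 (datumOfRecord₅ F N θ).C R w.γ (eP D) ∧ B14Cor3.LeafL1 (datumOfRecord₅ F N θ).C R w.γ ∧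
        B14Cor3.LeafL2 (datumOfRecord₅ F N θ).C R w.γ (eM D))
    (hlo : FlowStep.BetaLowerH w.b γ₀ D.βfun) (hhi : FlowStep.BetaUpperH w.βup γ₀ D.βfun) :
    B16.EndStatementBPrinted D.C :=
  have h₅ : IsRecordOfRecord₅C F N D w := isRecordOfRecord₅C_of_isRecordOfRecord₈C h
  N24_at_record₅C_knit_all_pinned h₅ hγ₀ slots₀₅ slots₀₆ slots₀₇ slots₀₈ (B12NodeKnitRecord8.b12_main_at_record₈C_of_leaf h hb12 h11T1 hcomp)
    slots₁₀ slots₁₁ slots₁₂ eM eP hR hcor hlo hhi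

/-- **N24 · (B2) at the Stage-8 record, ALL THIRTEEN children by name, β-binders READ AT THE MERGED β OF RECORD along the world's box `]0, w.γ]^{k+1}`** (γ₀ := w.γ; module 10's
`N24_betaLowerH_iff_merged₈` ∕ `N24_betaUpperH_iff_merged₈`).  ITS HYPOTHESIS LIST IS N24's «WHICH CHILD BLOCKS» AT THE RECORD OF RECORD: nine carrier slots (the Stage-₉ pins)
and two bounds on the merged β of [Balaban1987RG1] (1.22) (NODE O ∕ [I] p. 264) — nothing else. [cite: Balaban1989LargeFieldII, Thm 1 p.355 + pp.387, 391; Balaban1987RG1, (1.20)–(1.22) p.264, (2.12)–(2.14) p.268, Thm 1 p.259, Thm 3 p.264, Lemma 4 (3.53) p.280; Balaban1985RegularSpaces, Thms 2, 4, 8 pp.83–101; Balaban1985BackgroundPropagators, Thms 3.1–3.15 pp.397–432; Balaban1985Variational, Thm 1 p.279; Balaban1985UV3, Thm 1 p.257 + Thm 2 p.272; Balaban1988RG2Cluster, Lemmas 1–3 pp.9, 11, 20; Balaban1988Convergent, Thm 1 p.262, p.244, Cor. 3 (2.50) p.264; Balaban1989LargeFieldI, Prop. 1 p.194 (bookkeeping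 over the Stage-8 record)] -/
theorem N24_at_record₈C_knit_all_of_betaMerged_pinned (h : IsRecordOfRecord₈C F N D w)
    (slots₀₅ : ∀ θ : Stage5Params F N, θ.Admissible → D = datumOfRecord₅ F N θ → (∀ P, w.up P = upOfRecord₅C F N θ P) → ∀ P : B12.RunParams,
      B8LeafR (θ.res.X P).d8 (θ.res.X P).L8 (θ.res.X P).C₂ (θ.res.X P).B₁' (θ.res.X P).B₀' (θ.res.X P).B₁ (θ.res.X P).B₂ (θ.res.X P).c₁
        (θ.res.X P).inp8 (θ.res.X P).B₀β (θ.res.X P).loc8 (θ.res.X P).fam8R (θ.res.X P).lan8 (θ.res.X P).cub8 (θ.res.X P).toAxial8)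
    (slots₀₆ : ∀ θ : Stage5Params F N, θ.Admissible → D = datumOfRecord₅ F N θ → (∀ P, w.up P = upOfRecord₅C F N θ P) → ∀ P : B12.RunParams,
      B9LeafX (θ.res.Y P))
    (slots₀₇ : ∀ θ : Stage5Params F N, θ.Admissible → D = datumOfRecord₅ F N θ → (∀ P, w.up P = upOfRecord₅C F N θ P) → ∀ P : B12.RunParams,
      B11Leaf (θ.res.Z P))
    (slots₀₈ : ∀ θ : Stage5Params F N, θ.Admissible → D = datumOfRecord₅ F N θ →
      (∀ P, w.up P = upOfRecord₅C F N θ P) → ∀ P : B12.RunParams,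
        ∃ (Xc : PrintedCarriersR) (I : Type) (C : B10Assembly.Consts) (T : I → B10.TowerRun),
          Nonempty (∀ i, B10Assembly.LeafSystem C (T i)) ∧ θ.res.X P = Xc.withTowerRuns10 T)
    (hb12 : ∀ θ : Stage8Params F N, θ.Admissible → D = datumOfRecord₅ F N (θ.toStage5 F N) → w.γ ≤ θ.γ →
      (∀ P, w.up P = upOfRecord₅C F N (θ.toStage5 F N) P) → ∀ P, B12Sec2to5.Lemma4Printed (θ.res.X P).F12 (θ.res.X P).c12)
    (h11T1 : ∀ θ : Stage8Params F N, θ.Admissible → D = datumOfRecord₅ F N (θ.toStage5 F N) → w.γ ≤ θ.γ →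
      ∀ (p : B12.RunParams) (k : ℕ), k ≤ p.K →
        ∀ V ∈ domAltOfRecord F N θ.ν p.K k, UkExists F N p.K k θ.εbg V ∧ UniqueUkOrbit F N p.K k θ.εbg V)
    (hcomp : ∀ θ : Stage8Params F N, θ.Admissible → D = datumOfRecord₅ F N (θ.toStage5 F N) → w.γ ≤ θ.γ →
      ∀ (p : B12.RunParams) (k : ℕ), k ≤ p.K →
        HCompT F N (TOfRecord F N) (chi7 F N θ) θ.εbg p.K (genSeq (betaOfRecord₈ F N θ) p.g0) k (domAltOfRecord F N θ.ν p.K k))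
    (slots₁₀ : ∀ θ : Stage5Params F N, θ.Admissible → D = datumOfRecord₅ F N θ →
      (∀ P, w.up P = upOfRecord₅C F N θ P) → ∀ P : B12.RunParams,
        B9LeafX (θ.res.Y P) →
          (B10.Thm1PrintedCompact (θ.res.X P).runs10 ∧ B10.Thm2Printed (θ.res.X P).runs10) →
            B11Leaf (θ.res.Z P) → B12Sec2to5.Lemma4Printed (θ.res.X P).F12 (θ.res.X P).c12 →
              B13.Lemma1Printed (θ.res.X P).S13 (θ.res.X P).c13 ∧ B13.Lemma2Printed (θ.res.X P).S13 (θ.res.X P).c13 ∧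
                B13.Lemma3Printed (θ.res.X P).S13 (θ.res.X P).c13)
    (slots₁₁ : ∀ θ : Stage5Params F N, θ.Admissible → D = datumOfRecord₅ F N θ →
      (∀ P, w.up P = upOfRecord₅C F N θ P) → ∀ P : B12.RunParams,
        ∃ S Scorr : (k : ℕ) → Density (F.P P.K) k (SU N) → Prop,
          (ROpLeaf (θ.res.V P) → B14.RAssumedP244 (θ.res.R P) Scorr S P.K) ∧
          (∀ k, k ≤ P.K → S k (densOfRecord₅ F N θ P k) → θ.res.S218 P k (densOfRecord₅ F N θ P k)) ∧
          ((leavesP w P).smallCouplings → S 0 (rhoZeroOfRecord F N P.K P.g0 (θ.res.E P))) ∧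
          ((leavesP w P).b7 → (leavesP w P).b8 → (leavesP w P).b9 → (leavesP w P).b10 → (leavesP w P).b11 →
            (leavesP w P).smallCouplings → (leavesP w P).smallFieldInductive → (leavesP w P).flowControl →
              ∀ k, k < P.K → S k (densOfRecord₅ F N θ P k) →
                Scorr (k + 1) (TrhoOfRecord F N P.K k (densOfRecord₅ F N θ P k))))
    (slots₁₂ : ∀ θ : Stage5Params F N, θ.Admissible → D = datumOfRecord₅ F N θ → (∀ P, w.up P = upOfRecord₅C F N θ P) → ∀ P : B12.RunParams,
      B15Leaf (θ.res.W P))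
    (eM eP : FiniteEpsData F (SU N) → ℝ → ℝ) (hR : ∀ P : B12.RunParams, (w.up P).rOperation)
    (hcor : ∀ θ : Stage5Params F N, θ.Admissible → D = datumOfRecord₅ F N θ →
      ∃ R : B14Cor3.ReprFamily (datumOfRecord₅ F N θ).C,
        B14Cor3.LeafH (datumOfRecord₅ F N θ).C R w.γ ∧ B14Cor3.LeafU1 (datumOfRecord₅ F N θ).C R w.γ ∧
        B14Cor3.LeafU2 (datumOfRecord₅ F N θ).C R w.γ (eP D) ∧ B14Cor3.LeafL1 (datumOfRecord₅ F N θ).C R w.γ ∧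
        B14Cor3.LeafL2 (datumOfRecord₅ F N θ).C R w.γ (eM D))
    (hβm : ∀ θ : Stage8Params F N, θ.Admissible → D = datumOfRecord₅ F N (θ.toStage5 F N) → w.γ ≤ θ.γ →
      letI := θ.instVβ₁; letI := θ.instVβ₂; letI := θ.instιβ
      FlowStep.BetaLowerH w.b w.γ (betaMerged F (mergedTermFamilyMat F N (chi7 F N θ) θ.εbg) θ.ρ8 θ.bV) ∧
        FlowStep.BetaUpperH w.βup w.γ (betaMerged F (mergedTermFamilyMat F N (chi7 F N θ) θ.εbg) θ.ρ8 θ.bV)) :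
    B16.EndStatementBPrinted D.C := by
  obtain ⟨θ, hθ, hD, -, hγ, -, -⟩ := id h
  obtain ⟨hlo, hhi⟩ := hβm θ hθ hD hγ.2
  exact N24_at_record₈C_knit_all_pinned h le_rfl slots₀₅ slots₀₆ slots₀₇ slots₀₈ hb12 h11T1 hcomp slots₁₀ slots₁₁ slots₁₂ eM eP hR hcor
    ((N24_betaLowerH_iff_merged₈ θ hD hγ.2).mpr hlo) ((N24_betaUpperH_iff_merged₈ θ hD hγ.2).mpr hhi)

/-- **N24 · (B2) at the Stage-8 record, ALL THIRTEEN children by name, β-binders AT THE β OF RECORD `betaOfRecord₈ θ`** over the record's parameters (every admissible `θ` presenting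
`D` with `w.γ ≤ θ.γ`), any `γ₀ ≥ w.γ` (module 10's `N24_at_record₈C_of_betaOfRecord₈` pattern: `D.βfun = betaOfRecord₈ θ` by `βfun_stage8`).
[cite: Balaban1989LargeFieldII, Thm 1 p.355 + pp.387, 391; Balaban1987RG1, (1.20)–(1.22) p.264, Thm 1 p.259, Thm 3 p.264; Balaban1988Convergent, Thm 1 p.262, Cor. 3 (2.50) p.264 (bookkeeping over the Stage-8 record)] -/
theorem N24_at_record₈C_knit_all_of_betaOfRecord₈_pinned (h : IsRecordOfRecord₈C F N D w) {γ₀ : ℝ} (hγ₀ : w.γ ≤ γ₀)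
    (slots₀₅ : ∀ θ : Stage5Params F N, θ.Admissible → D = datumOfRecord₅ F N θ → (∀ P, w.up P = upOfRecord₅C F N θ P) → ∀ P : B12.RunParams,
      B8LeafR (θ.res.X P).d8 (θ.res.X P).L8 (θ.res.X P).C₂ (θ.res.X P).B₁' (θ.res.X P).B₀' (θ.res.X P).B₁ (θ.res.X P).B₂ (θ.res.X P).c₁
        (θ.res.X P).inp8 (θ.res.X P).B₀β (θ.res.X P).loc8 (θ.res.X P).fam8R (θ.res.X P).lan8 (θ.res.X P).cub8 (θ.res.X P).toAxial8)
    (slots₀₆ : ∀ θ : Stage5Params F N, θ.Admissible → D = datumOfRecord₅ F N θ → (∀ P, w.up P = upOfRecord₅C F N θ P) → ∀ P : B12.RunParams,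
      B9LeafX (θ.res.Y P))
    (slots₀₇ : ∀ θ : Stage5Params F N, θ.Admissible → D = datumOfRecord₅ F N θ → (∀ P, w.up P = upOfRecord₅C F N θ P) → ∀ P : B12.RunParams,
      B11Leaf (θ.res.Z P))
    (slots₀₈ : ∀ θ : Stage5Params F N, θ.Admissible → D = datumOfRecord₅ F N θ →
      (∀ P, w.up P = upOfRecord₅C F N θ P) → ∀ P : B12.RunParams,
        ∃ (Xc : PrintedCarriersR) (I : Type) (C : B10Assembly.Consts) (T : I → B10.TowerRun),
          Nonempty (∀ i, B10Assembly.LeafSystem C (T i)) ∧ θ.res.X P = Xc.withTowerRuns10 T)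
    (hb12 : ∀ θ : Stage8Params F N, θ.Admissible → D = datumOfRecord₅ F N (θ.toStage5 F N) → w.γ ≤ θ.γ →
      (∀ P, w.up P = upOfRecord₅C F N (θ.toStage5 F N) P) → ∀ P, B12Sec2to5.Lemma4Printed (θ.res.X P).F12 (θ.res.X P).c12)
    (h11T1 : ∀ θ : Stage8Params F N, θ.Admissible → D = datumOfRecord₅ F N (θ.toStage5 F N) → w.γ ≤ θ.γ →
      ∀ (p : B12.RunParams) (k : ℕ), k ≤ p.K →
        ∀ V ∈ domAltOfRecord F N θ.ν p.K k, UkExists F N p.K k θ.εbg V ∧ UniqueUkOrbit F N p.K k θ.εbg V)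
    (hcomp : ∀ θ : Stage8Params F N, θ.Admissible → D = datumOfRecord₅ F N (θ.toStage5 F N) → w.γ ≤ θ.γ →
      ∀ (p : B12.RunParams) (k : ℕ), k ≤ p.K →
        HCompT F N (TOfRecord F N) (chi7 F N θ) θ.εbg p.K (genSeq (betaOfRecord₈ F N θ) p.g0) k (domAltOfRecord F N θ.ν p.K k))
    (slots₁₀ : ∀ θ : Stage5Params F N, θ.Admissible → D = datumOfRecord₅ F N θ →
      (∀ P, w.up P = upOfRecord₅C F N θ P) → ∀ P : B12.RunParams,
        B9LeafX (θ.res.Y P) →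
          (B10.Thm1PrintedCompact (θ.res.X P).runs10 ∧ B10.Thm2Printed (θ.res.X P).runs10) →
            B11Leaf (θ.res.Z P) → B12Sec2to5.Lemma4Printed (θ.res.X P).F12 (θ.res.X P).c12 →
              B13.Lemma1Printed (θ.res.X P).S13 (θ.res.X P).c13 ∧ B13.Lemma2Printed (θ.res.X P).S13 (θ.res.X P).c13 ∧
                B13.Lemma3Printed (θ.res.X P).S13 (θ.res.X P).c13)
    (slots₁₁ : ∀ θ : Stage5Params F N, θ.Admissible → D = datumOfRecord₅ F N θ →
      (∀ P, w.up P = upOfRecord₅C F N θ P) → ∀ P : B12.RunParams,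
        ∃ S Scorr : (k : ℕ) → Density (F.P P.K) k (SU N) → Prop,
          (ROpLeaf (θ.res.V P) → B14.RAssumedP244 (θ.res.R P) Scorr S P.K) ∧
          (∀ k, k ≤ P.K → S k (densOfRecord₅ F N θ P k) → θ.res.S218 P k (densOfRecord₅ F N θ P k)) ∧
          ((leavesP w P).smallCouplings → S 0 (rhoZeroOfRecord F N P.K P.g0 (θ.res.E P))) ∧
          ((leavesP w P).b7 → (leavesP w P).b8 → (leavesP w P).b9 → (leavesP w P).b10 → (leavesP w P).b11 →
            (leavesP w P).smallCouplings → (leavesP w P).smallFieldInductive → (leavesP w P).flowControl →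
              ∀ k, k < P.K → S k (densOfRecord₅ F N θ P k) →
                Scorr (k + 1) (TrhoOfRecord F N P.K k (densOfRecord₅ F N θ P k))))
    (slots₁₂ : ∀ θ : Stage5Params F N, θ.Admissible → D = datumOfRecord₅ F N θ → (∀ P, w.up P = upOfRecord₅C F N θ P) → ∀ P : B12.RunParams,
      B15Leaf (θ.res.W P))
    (eM eP : FiniteEpsData F (SU N) → ℝ → ℝ) (hR : ∀ P : B12.RunParams, (w.up P).rOperation)
    (hcor : ∀ θ : Stage5Params F N, θ.Admissible → D = datumOfRecord₅ F N θ →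
      ∃ R : B14Cor3.ReprFamily (datumOfRecord₅ F N θ).C,
        B14Cor3.LeafH (datumOfRecord₅ F N θ).C R w.γ ∧ B14Cor3.LeafU1 (datumOfRecord₅ F N θ).C R w.γ ∧
        B14Cor3.LeafU2 (datumOfRecord₅ F N θ).C R w.γ (eP D) ∧ B14Cor3.LeafL1 (datumOfRecord₅ F N θ).C R w.γ ∧
        B14Cor3.LeafL2 (datumOfRecord₅ F N θ).C R w.γ (eM D))
    (hβ : ∀ θ : Stage8Params F N, θ.Admissible → D = datumOfRecord₅ F N (θ.toStage5 F N) → w.γ ≤ θ.γ →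
      FlowStep.BetaLowerH w.b γ₀ (betaOfRecord₈ F N θ) ∧ FlowStep.BetaUpperH w.βup γ₀ (betaOfRecord₈ F N θ)) :
    B16.EndStatementBPrinted D.C := by
  obtain ⟨θ, hθ, hD, -, hγ, -, -⟩ := id h
  obtain ⟨hlo, hhi⟩ := hβ θ hθ hD hγ.2
  have hβfun : D.βfun = betaOfRecord₈ F N θ := by rw [hD]; exact βfun_stage8 F N θ
  exact N24_at_record₈C_knit_all_pinned h hγ₀ slots₀₅ slots₀₆ slots₀₇ slots₀₈ hb12 h11T1 hcomp slots₁₀ slots₁₁ slots₁₂ eM eP hR hcor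
    (hβfun ▸ hlo) (hβfun ▸ hhi)

/-! ## §3. The item body (stmt-QuantumFields-19183 `StabilityBAtRecord`, rev 0) at the Stage-8 record, every child by name -/

/-- **N24's rung body at the Stage-8 record, ALL THIRTEEN children by name, WITH THE K-INDEXED WINDOW**: the datum is NODE 00's datum of record at Stage 0
(`isDatumOfRecord₀_of_isRecordOfRecord₅C`), (B2) holds (`N24_at_record₈C_knit_all_pinned`), and for every `γ ∈ ]0, γ₀]`, every `m` and EVERY `K` some bare coupling `g₀ > 0`
runs `⟨K, m, g₀⟩` inside `]0, γ]` (module 8's `N24_window_allK_of_betaUpperH`, from `hhi` alone — elementary).  Count-neutral (N24 COMPOSITE).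
[cite: Balaban1989LargeFieldII, Thm 1 p.355 + p.391; Balaban1987RG1, (0.4) p.253, (0.18)–(0.20) pp.255–256, (1.22) and p.264; Balaban1988Convergent, Cor. 3 (2.50) p.264 (bookkeeping + elementary window)] -/
theorem N24_stabilityB_body₈C_knit_all_pinned (h : IsRecordOfRecord₈C F N D w) {γ₀ : ℝ} (hγ₀ : w.γ ≤ γ₀)
    (slots₀₅ : ∀ θ : Stage5Params F N, θ.Admissible → D = datumOfRecord₅ F N θ → (∀ P, w.up P = upOfRecord₅C F N θ P) → ∀ P : B12.RunParams,
      B8LeafR (θ.res.X P).d8 (θ.res.X P).L8 (θ.res.X P).C₂ (θ.res.X P).B₁' (θ.res.X P).B₀' (θ.res.X P).B₁ (θ.res.X P).B₂ (θ.res.X P).c₁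
        (θ.res.X P).inp8 (θ.res.X P).B₀β (θ.res.X P).loc8 (θ.res.X P).fam8R (θ.res.X P).lan8 (θ.res.X P).cub8 (θ.res.X P).toAxial8)
    (slots₀₆ : ∀ θ : Stage5Params F N, θ.Admissible → D = datumOfRecord₅ F N θ → (∀ P, w.up P = upOfRecord₅C F N θ P) → ∀ P : B12.RunParams,
      B9LeafX (θ.res.Y P))
    (slots₀₇ : ∀ θ : Stage5Params F N, θ.Admissible → D = datumOfRecord₅ F N θ → (∀ P, w.up P = upOfRecord₅C F N θ P) → ∀ P : B12.RunParams,
      B11Leaf (θ.res.Z P))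
    (slots₀₈ : ∀ θ : Stage5Params F N, θ.Admissible → D = datumOfRecord₅ F N θ →
      (∀ P, w.up P = upOfRecord₅C F N θ P) → ∀ P : B12.RunParams,
        ∃ (Xc : PrintedCarriersR) (I : Type) (C : B10Assembly.Consts) (T : I → B10.TowerRun),
          Nonempty (∀ i, B10Assembly.LeafSystem C (T i)) ∧ θ.res.X P = Xc.withTowerRuns10 T)
    (hb12 : ∀ θ : Stage8Params F N, θ.Admissible → D = datumOfRecord₅ F N (θ.toStage5 F N) → w.γ ≤ θ.γ →
      (∀ P, w.up P = upOfRecord₅C F N (θ.toStage5 F N) P) → ∀ P, B12Sec2to5.Lemma4Printed (θ.res.X P).F12 (θ.res.X P).c12)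
    (h11T1 : ∀ θ : Stage8Params F N, θ.Admissible → D = datumOfRecord₅ F N (θ.toStage5 F N) → w.γ ≤ θ.γ →
      ∀ (p : B12.RunParams) (k : ℕ), k ≤ p.K →
        ∀ V ∈ domAltOfRecord F N θ.ν p.K k, UkExists F N p.K k θ.εbg V ∧ UniqueUkOrbit F N p.K k θ.εbg V)
    (hcomp : ∀ θ : Stage8Params F N, θ.Admissible → D = datumOfRecord₅ F N (θ.toStage5 F N) → w.γ ≤ θ.γ →
      ∀ (p : B12.RunParams) (k : ℕ), k ≤ p.K →
        HCompT F N (TOfRecord F N) (chi7 F N θ) θ.εbg p.K (genSeq (betaOfRecord₈ F N θ) p.g0) k (domAltOfRecord F N θ.ν p.K k))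
    (slots₁₀ : ∀ θ : Stage5Params F N, θ.Admissible → D = datumOfRecord₅ F N θ →
      (∀ P, w.up P = upOfRecord₅C F N θ P) → ∀ P : B12.RunParams,
        B9LeafX (θ.res.Y P) →
          (B10.Thm1PrintedCompact (θ.res.X P).runs10 ∧ B10.Thm2Printed (θ.res.X P).runs10) →
            B11Leaf (θ.res.Z P) → B12Sec2to5.Lemma4Printed (θ.res.X P).F12 (θ.res.X P).c12 →
              B13.Lemma1Printed (θ.res.X P).S13 (θ.res.X P).c13 ∧ B13.Lemma2Printed (θ.res.X P).S13 (θ.res.X P).c13 ∧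
                B13.Lemma3Printed (θ.res.X P).S13 (θ.res.X P).c13)
    (slots₁₁ : ∀ θ : Stage5Params F N, θ.Admissible → D = datumOfRecord₅ F N θ →
      (∀ P, w.up P = upOfRecord₅C F N θ P) → ∀ P : B12.RunParams,
        ∃ S Scorr : (k : ℕ) → Density (F.P P.K) k (SU N) → Prop,
          (ROpLeaf (θ.res.V P) → B14.RAssumedP244 (θ.res.R P) Scorr S P.K) ∧
          (∀ k, k ≤ P.K → S k (densOfRecord₅ F N θ P k) → θ.res.S218 P k (densOfRecord₅ F N θ P k)) ∧
          ((leavesP w P).smallCouplings → S 0 (rhoZeroOfRecord F N P.K P.g0 (θ.res.E P))) ∧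
          ((leavesP w P).b7 → (leavesP w P).b8 → (leavesP w P).b9 → (leavesP w P).b10 → (leavesP w P).b11 →
            (leavesP w P).smallCouplings → (leavesP w P).smallFieldInductive → (leavesP w P).flowControl →
              ∀ k, k < P.K → S k (densOfRecord₅ F N θ P k) →
                Scorr (k + 1) (TrhoOfRecord F N P.K k (densOfRecord₅ F N θ P k))))
    (slots₁₂ : ∀ θ : Stage5Params F N, θ.Admissible → D = datumOfRecord₅ F N θ → (∀ P, w.up P = upOfRecord₅C F N θ P) → ∀ P : B12.RunParams,
      B15Leaf (θ.res.W P))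
    (eM eP : FiniteEpsData F (SU N) → ℝ → ℝ) (hR : ∀ P : B12.RunParams, (w.up P).rOperation)
    (hcor : ∀ θ : Stage5Params F N, θ.Admissible → D = datumOfRecord₅ F N θ →
      ∃ R : B14Cor3.ReprFamily (datumOfRecord₅ F N θ).C,
        B14Cor3.LeafH (datumOfRecord₅ F N θ).C R w.γ ∧ B14Cor3.LeafU1 (datumOfRecord₅ F N θ).C R w.γ ∧
        B14Cor3.LeafU2 (datumOfRecord₅ F N θ).C R w.γ (eP D) ∧ B14Cor3.LeafL1 (datumOfRecord₅ F N θ).C R w.γ ∧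
        B14Cor3.LeafL2 (datumOfRecord₅ F N θ).C R w.γ (eM D))
    (hlo : FlowStep.BetaLowerH w.b γ₀ D.βfun) (hhi : FlowStep.BetaUpperH w.βup γ₀ D.βfun) :
    IsDatumOfRecord₀ F N D ∧ B16.EndStatementBPrinted D.C ∧
      ∀ γ : ℝ, 0 < γ → γ ≤ γ₀ → ∀ m K : ℕ, ∃ g0 : ℝ, 0 < g0 ∧ (D.C ⟨K, m, g0⟩).flow.InInterval γ K :=
  ⟨isDatumOfRecord₀_of_isRecordOfRecord₅C (isRecordOfRecord₅C_of_isRecordOfRecord₈C h),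
    N24_at_record₈C_knit_all_pinned h hγ₀ slots₀₅ slots₀₆ slots₀₇ slots₀₈ hb12 h11T1 hcomp slots₁₀ slots₁₁ slots₁₂ eM eP hR hcor hlo hhi,
    fun _ hγ hγle m K => N24_window_allK_of_betaUpperH D hhi hγ hγle m K⟩

/-- **The same in the LITERAL SHAPE of item stmt-QuantumFields-19183's body (rev 0)** at general `N` — `IsDatumOfRecord₀ F N D ∧ B16.EndStatementBPrinted D.C ∧
∃ γ₁ > 0, ∀ γ ∈ ]0, γ₁], ∃ P, (D.C P).flow.InInterval γ P.K` — with `γ₁ := γ₀` (positive: `0 < w.γ ≤ γ₀`) and, for each window, the run `⟨K, m, g₀⟩` of the K-indexed form at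
any prescribed `K m` (here the caller's `K m`; the K-indexed theorem above is the non-vacuous content).  Summits-side one-liner material for the route's glue; nothing
of the item is asserted here (the record, the nine slots and the β-box are hypotheses). [cite: Balaban1989LargeFieldII, Thm 1 p.355 + p.391; Balaban1987RG1, (0.4) p.253 and p.264 (bookkeeping)] -/
theorem N24_stabilityB_itemShape₈C_knit_all_pinned (h : IsRecordOfRecord₈C F N D w) {γ₀ : ℝ} (hγ₀ : w.γ ≤ γ₀) (K m : ℕ)
    (slots₀₅ : ∀ θ : Stage5Params F N, θ.Admissible → D = datumOfRecord₅ F N θ → (∀ P, w.up P = upOfRecord₅C F N θ P) → ∀ P : B12.RunParams,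
      B8LeafR (θ.res.X P).d8 (θ.res.X P).L8 (θ.res.X P).C₂ (θ.res.X P).B₁' (θ.res.X P).B₀' (θ.res.X P).B₁ (θ.res.X P).B₂ (θ.res.X P).c₁
        (θ.res.X P).inp8 (θ.res.X P).B₀β (θ.res.X P).loc8 (θ.res.X P).fam8R (θ.res.X P).lan8 (θ.res.X P).cub8 (θ.res.X P).toAxial8)
    (slots₀₆ : ∀ θ : Stage5Params F N, θ.Admissible → D = datumOfRecord₅ F N θ → (∀ P, w.up P = upOfRecord₅C F N θ P) → ∀ P : B12.RunParams,
      B9LeafX (θ.res.Y P))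
    (slots₀₇ : ∀ θ : Stage5Params F N, θ.Admissible → D = datumOfRecord₅ F N θ → (∀ P, w.up P = upOfRecord₅C F N θ P) → ∀ P : B12.RunParams,
      B11Leaf (θ.res.Z P))
    (slots₀₈ : ∀ θ : Stage5Params F N, θ.Admissible → D = datumOfRecord₅ F N θ →
      (∀ P, w.up P = upOfRecord₅C F N θ P) → ∀ P : B12.RunParams,
        ∃ (Xc : PrintedCarriersR) (I : Type) (C : B10Assembly.Consts) (T : I → B10.TowerRun),
          Nonempty (∀ i, B10Assembly.LeafSystem C (T i)) ∧ θ.res.X P = Xc.withTowerRuns10 T)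
    (hb12 : ∀ θ : Stage8Params F N, θ.Admissible → D = datumOfRecord₅ F N (θ.toStage5 F N) → w.γ ≤ θ.γ →
      (∀ P, w.up P = upOfRecord₅C F N (θ.toStage5 F N) P) → ∀ P, B12Sec2to5.Lemma4Printed (θ.res.X P).F12 (θ.res.X P).c12)
    (h11T1 : ∀ θ : Stage8Params F N, θ.Admissible → D = datumOfRecord₅ F N (θ.toStage5 F N) → w.γ ≤ θ.γ →
      ∀ (p : B12.RunParams) (k : ℕ), k ≤ p.K →
        ∀ V ∈ domAltOfRecord F N θ.ν p.K k, UkExists F N p.K k θ.εbg V ∧ UniqueUkOrbit F N p.K k θ.εbg V)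
    (hcomp : ∀ θ : Stage8Params F N, θ.Admissible → D = datumOfRecord₅ F N (θ.toStage5 F N) → w.γ ≤ θ.γ →
      ∀ (p : B12.RunParams) (k : ℕ), k ≤ p.K →
        HCompT F N (TOfRecord F N) (chi7 F N θ) θ.εbg p.K (genSeq (betaOfRecord₈ F N θ) p.g0) k (domAltOfRecord F N θ.ν p.K k))
    (slots₁₀ : ∀ θ : Stage5Params F N, θ.Admissible → D = datumOfRecord₅ F N θ →
      (∀ P, w.up P = upOfRecord₅C F N θ P) → ∀ P : B12.RunParams,
        B9LeafX (θ.res.Y P) →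
          (B10.Thm1PrintedCompact (θ.res.X P).runs10 ∧ B10.Thm2Printed (θ.res.X P).runs10) →
            B11Leaf (θ.res.Z P) → B12Sec2to5.Lemma4Printed (θ.res.X P).F12 (θ.res.X P).c12 →
              B13.Lemma1Printed (θ.res.X P).S13 (θ.res.X P).c13 ∧ B13.Lemma2Printed (θ.res.X P).S13 (θ.res.X P).c13 ∧
                B13.Lemma3Printed (θ.res.X P).S13 (θ.res.X P).c13)
    (slots₁₁ : ∀ θ : Stage5Params F N, θ.Admissible → D = datumOfRecord₅ F N θ →
      (∀ P, w.up P = upOfRecord₅C F N θ P) → ∀ P : B12.RunParams,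
        ∃ S Scorr : (k : ℕ) → Density (F.P P.K) k (SU N) → Prop,
          (ROpLeaf (θ.res.V P) → B14.RAssumedP244 (θ.res.R P) Scorr S P.K) ∧
          (∀ k, k ≤ P.K → S k (densOfRecord₅ F N θ P k) → θ.res.S218 P k (densOfRecord₅ F N θ P k)) ∧
          ((leavesP w P).smallCouplings → S 0 (rhoZeroOfRecord F N P.K P.g0 (θ.res.E P))) ∧
          ((leavesP w P).b7 → (leavesP w P).b8 → (leavesP w P).b9 → (leavesP w P).b10 → (leavesP w P).b11 →
            (leavesP w P).smallCouplings → (leavesP w P).smallFieldInductive → (leavesP w P).flowControl →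
              ∀ k, k < P.K → S k (densOfRecord₅ F N θ P k) →
                Scorr (k + 1) (TrhoOfRecord F N P.K k (densOfRecord₅ F N θ P k))))
    (slots₁₂ : ∀ θ : Stage5Params F N, θ.Admissible → D = datumOfRecord₅ F N θ → (∀ P, w.up P = upOfRecord₅C F N θ P) → ∀ P : B12.RunParams,
      B15Leaf (θ.res.W P))
    (eM eP : FiniteEpsData F (SU N) → ℝ → ℝ) (hR : ∀ P : B12.RunParams, (w.up P).rOperation)
    (hcor : ∀ θ : Stage5Params F N, θ.Admissible → D = datumOfRecord₅ F N θ →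
      ∃ R : B14Cor3.ReprFamily (datumOfRecord₅ F N θ).C,
        B14Cor3.LeafH (datumOfRecord₅ F N θ).C R w.γ ∧ B14Cor3.LeafU1 (datumOfRecord₅ F N θ).C R w.γ ∧
        B14Cor3.LeafU2 (datumOfRecord₅ F N θ).C R w.γ (eP D) ∧ B14Cor3.LeafL1 (datumOfRecord₅ F N θ).C R w.γ ∧
        B14Cor3.LeafL2 (datumOfRecord₅ F N θ).C R w.γ (eM D))
    (hlo : FlowStep.BetaLowerH w.b γ₀ D.βfun) (hhi : FlowStep.BetaUpperH w.βup γ₀ D.βfun) :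
    IsDatumOfRecord₀ F N D ∧ B16.EndStatementBPrinted D.C ∧
      ∃ γ₁ : ℝ, 0 < γ₁ ∧ ∀ γ : ℝ, 0 < γ → γ ≤ γ₁ → ∃ P : B12.RunParams, (D.C P).flow.InInterval γ P.K := by
  obtain ⟨h₀, hB, hwin⟩ := N24_stabilityB_body₈C_knit_all_pinned h hγ₀ slots₀₅ slots₀₆ slots₀₇ slots₀₈ hb12 h11T1 hcomp slots₁₀ slots₁₁ slots₁₂
    eM eP hR hcor hlo hhi
  refine ⟨h₀, hB, γ₀, (gamma_pos_of_isRecordOfRecord₅C (isRecordOfRecord₅C_of_isRecordOfRecord₈C h)).trans_le hγ₀, fun γ hγ hγle => ?_⟩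
  obtain ⟨g0, -, hrun⟩ := hwin γ hγ hγle m K
  exact ⟨⟨K, m, g0⟩, hrun⟩


/-! ## §4. GIVEN B3 (NODE O, `BetaPertH D.βfun β̄` with `0 < β̄`): at the γ-lowered Stage-8 record world the SLOTS ALONE give (B2) -/

/-- **N24 at the Stage-8 record GIVEN B3, every child by name — the γ-BLIND sockets at `w`, the γ-reading slots at the lowered world.**  From an `₈C` record `(D, w)`, B3 at
`D.βfun` and the six carrier sockets ∕ slots that read only `w.up` (N05 N06 N07 N08 N10 N12) plus N13's 𝐑-leaf, there is an explicit γ-lowered `₈C` record world `w'` over `D`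
(module 10's `N24_isRecordOfRecord₈C_reletter`: same `C`, `up`, `L`, exponent letters; `γ := min w.γ γᵦ`; `(b, β⁺)` := B3's box bounds, module 12's `N24_betaBox_of_betaPertH`)
at which «N11's slots + N09's three Stage-8 slots + N13's exponent families and Cor.-3 leaves (all displayed AT `w'`: they read the window) ⇒ `B16.EndStatementBPrinted D.C`»
— §2's `N24_at_record₈C_knit_all_pinned` at `w'` with the B3 bounds on `]0, w'.γ]` by `FlowStep.box_mono`.  No separate β-binder: the β-window IS B3 (N25's statement about
the β of record; at the zero chart B3 is FALSE, `βfun_datumOfRecord₈_of_zeroChart` — ref-D N-n24-12 ∕ ZEROCHART v0.33: no typed realiser satisfies B3 yet).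
[cite: Balaban1989LargeFieldII, Thm 1 p.355 + pp.387, 391 («γ sufficiently small»); Balaban1987RG1, (1.20)–(1.22) p.264, Thm 1 p.259, Thm 3 p.264, Lemma 4 (3.53) p.280; Balaban1988Convergent, Thm 1 p.262, p.244, Cor. 3 (2.50) p.264 (bookkeeping over the Stage-8 record)] -/
theorem N24_lowered_slots₈C_of_betaPertH_pinned (h : IsRecordOfRecord₈C F N D w) {βbar : ℝ} (hbar : 0 < βbar) (hP : BetaPertH D.βfun βbar)
    (slots₀₅ : ∀ θ : Stage5Params F N, θ.Admissible → D = datumOfRecord₅ F N θ → (∀ P, w.up P = upOfRecord₅C F N θ P) → ∀ P : B12.RunParams,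
      B8LeafR (θ.res.X P).d8 (θ.res.X P).L8 (θ.res.X P).C₂ (θ.res.X P).B₁' (θ.res.X P).B₀' (θ.res.X P).B₁ (θ.res.X P).B₂ (θ.res.X P).c₁
        (θ.res.X P).inp8 (θ.res.X P).B₀β (θ.res.X P).loc8 (θ.res.X P).fam8R (θ.res.X P).lan8 (θ.res.X P).cub8 (θ.res.X P).toAxial8)
    (slots₀₆ : ∀ θ : Stage5Params F N, θ.Admissible → D = datumOfRecord₅ F N θ → (∀ P, w.up P = upOfRecord₅C F N θ P) → ∀ P : B12.RunParams,
      B9LeafX (θ.res.Y P))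
    (slots₀₇ : ∀ θ : Stage5Params F N, θ.Admissible → D = datumOfRecord₅ F N θ → (∀ P, w.up P = upOfRecord₅C F N θ P) → ∀ P : B12.RunParams,
      B11Leaf (θ.res.Z P))
    (slots₀₈ : ∀ θ : Stage5Params F N, θ.Admissible → D = datumOfRecord₅ F N θ →
      (∀ P, w.up P = upOfRecord₅C F N θ P) → ∀ P : B12.RunParams,
        ∃ (Xc : PrintedCarriersR) (I : Type) (C : B10Assembly.Consts) (T : I → B10.TowerRun),
          Nonempty (∀ i, B10Assembly.LeafSystem C (T i)) ∧ θ.res.X P = Xc.withTowerRuns10 T)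
    (slots₁₀ : ∀ θ : Stage5Params F N, θ.Admissible → D = datumOfRecord₅ F N θ →
      (∀ P, w.up P = upOfRecord₅C F N θ P) → ∀ P : B12.RunParams,
        B9LeafX (θ.res.Y P) →
          (B10.Thm1PrintedCompact (θ.res.X P).runs10 ∧ B10.Thm2Printed (θ.res.X P).runs10) →
            B11Leaf (θ.res.Z P) → B12Sec2to5.Lemma4Printed (θ.res.X P).F12 (θ.res.X P).c12 →
              B13.Lemma1Printed (θ.res.X P).S13 (θ.res.X P).c13 ∧ B13.Lemma2Printed (θ.res.X P).S13 (θ.res.X P).c13 ∧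
                B13.Lemma3Printed (θ.res.X P).S13 (θ.res.X P).c13)
    (slots₁₂ : ∀ θ : Stage5Params F N, θ.Admissible → D = datumOfRecord₅ F N θ → (∀ P, w.up P = upOfRecord₅C F N θ P) → ∀ P : B12.RunParams,
      B15Leaf (θ.res.W P))
    (hR : ∀ P : B12.RunParams, (w.up P).rOperation) :
    ∃ w' : WorldP, IsRecordOfRecord₈C F N D w' ∧ w'.C = w.C ∧ w'.up = w.up ∧ w'.L = w.L ∧ w'.em = w.em ∧ w'.ep = w.ep ∧
      0 < w'.γ ∧ w'.γ ≤ w.γ ∧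
      ((∀ θ : Stage8Params F N, θ.Admissible → D = datumOfRecord₅ F N (θ.toStage5 F N) → w'.γ ≤ θ.γ →
          (∀ P, w'.up P = upOfRecord₅C F N (θ.toStage5 F N) P) → ∀ P, B12Sec2to5.Lemma4Printed (θ.res.X P).F12 (θ.res.X P).c12) →
        (∀ θ : Stage8Params F N, θ.Admissible → D = datumOfRecord₅ F N (θ.toStage5 F N) → w'.γ ≤ θ.γ →
          ∀ (p : B12.RunParams) (k : ℕ), k ≤ p.K →
            ∀ V ∈ domAltOfRecord F N θ.ν p.K k, UkExists F N p.K k θ.εbg V ∧ UniqueUkOrbit F N p.K k θ.εbg V) →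
        (∀ θ : Stage8Params F N, θ.Admissible → D = datumOfRecord₅ F N (θ.toStage5 F N) → w'.γ ≤ θ.γ →
          ∀ (p : B12.RunParams) (k : ℕ), k ≤ p.K →
            HCompT F N (TOfRecord F N) (chi7 F N θ) θ.εbg p.K (genSeq (betaOfRecord₈ F N θ) p.g0) k (domAltOfRecord F N θ.ν p.K k)) →
        (∀ θ : Stage5Params F N, θ.Admissible → D = datumOfRecord₅ F N θ →
          (∀ P, w'.up P = upOfRecord₅C F N θ P) → ∀ P : B12.RunParams,
            ∃ S Scorr : (k : ℕ) → Density (F.P P.K) k (SU N) → Prop,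
              (ROpLeaf (θ.res.V P) → B14.RAssumedP244 (θ.res.R P) Scorr S P.K) ∧
              (∀ k, k ≤ P.K → S k (densOfRecord₅ F N θ P k) → θ.res.S218 P k (densOfRecord₅ F N θ P k)) ∧
              ((leavesP w' P).smallCouplings → S 0 (rhoZeroOfRecord F N P.K P.g0 (θ.res.E P))) ∧
              ((leavesP w' P).b7 → (leavesP w' P).b8 → (leavesP w' P).b9 → (leavesP w' P).b10 → (leavesP w' P).b11 →
                (leavesP w' P).smallCouplings → (leavesP w' P).smallFieldInductive → (leavesP w' P).flowControl →
                  ∀ k, k < P.K → S k (densOfRecord₅ F N θ P k) →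
                    Scorr (k + 1) (TrhoOfRecord F N P.K k (densOfRecord₅ F N θ P k)))) →
        ∀ (eM eP : FiniteEpsData F (SU N) → ℝ → ℝ),
        (∀ θ : Stage5Params F N, θ.Admissible → D = datumOfRecord₅ F N θ →
          ∃ R : B14Cor3.ReprFamily (datumOfRecord₅ F N θ).C,
            B14Cor3.LeafH (datumOfRecord₅ F N θ).C R w'.γ ∧ B14Cor3.LeafU1 (datumOfRecord₅ F N θ).C R w'.γ ∧
            B14Cor3.LeafU2 (datumOfRecord₅ F N θ).C R w'.γ (eP D) ∧ B14Cor3.LeafL1 (datumOfRecord₅ F N θ).C R w'.γ ∧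
            B14Cor3.LeafL2 (datumOfRecord₅ F N θ).C R w'.γ (eM D)) →
        B16.EndStatementBPrinted D.C) := by
  obtain ⟨γβ, b, βup, hγβ, hb, hlo, hhi⟩ := N24_betaBox_of_betaPertH hbar hP
  have hwγ : 0 < w.γ := gamma_pos_of_isRecordOfRecord₅C (isRecordOfRecord₅C_of_isRecordOfRecord₈C h)
  have hγ' : 0 < min w.γ γβ := lt_min hwγ hγβ
  have h' : IsRecordOfRecord₈C F N D { w with γ := min w.γ γβ, b := b, b_pos := hb, βup := βup, em := w.em, ep := w.ep } :=
    N24_isRecordOfRecord₈C_reletter h hγ' (min_le_left _ _) hb βup w.em w.ep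
  refine ⟨{ w with γ := min w.γ γβ, b := b, b_pos := hb, βup := βup, em := w.em, ep := w.ep }, h', rfl, rfl, rfl, rfl, rfl, hγ',
    min_le_left _ _, fun hb12 h11T1 hcomp slots₁₁ eM eP hcor => ?_⟩
  exact N24_at_record₈C_knit_all_pinned h' le_rfl slots₀₅ slots₀₆ slots₀₇ slots₀₈ hb12 h11T1 hcomp slots₁₀ slots₁₁ slots₁₂ eM eP hR hcor
    (fun k v hv => hlo k v (box_mono (min_le_right _ _) k hv)) fun k v hv => hhi k v (box_mono (min_le_right _ _) k hv)


end Literature.MathematicalPhysics.QuantumFieldTheory.Balaban1983to89.Node00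

end
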